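import Mathlib
import Summits.Ventures.PercRepro2.Defs
import Summits.Ventures.PercRepro2.Independence
import Summits.Ventures.PercRepro2.Harris
import Summits.Ventures.PercRepro2.Graph
import Summits.Ventures.PercRepro2.Exploration
import Summits.Ventures.PercRepro2.Events
import Summits.Ventures.PercRepro2.FourFunctions
import Summits.Ventures.PercRepro2.Induced
import Summits.Ventures.PercRepro2.Frontier
import Summits.Ventures.PercRepro2.ObsIndependence
import Summits.Ventures.PercRepro2.BHK
import Summits.Ventures.PercRepro2.BHKEvents
import Summits.Ventures.PercRepro2.BHKAvoid
import Summits.Ventures.PercRepro2.SameClusterAvoid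
import Summits.Ventures.PercRepro2.CaseOneRegime
import Summits.Ventures.PercRepro2.CaseOnePos
import Summits.Ventures.PercRepro2.CaseOneJ11
import Summits.Ventures.PercRepro2.CaseOneRV
import Summits.Ventures.PercRepro2.TriDisagreement
import Summits.Ventures.PercRepro2.HCovCubic

import Summits.Ventures.PercRepro2.CaseOneCubic

/-!
# The `(i)`-side state kernel `KI` with `iExpr = triSum p ∅ τ KI`, and `(i)` from the typed bases
(blind cell PercRepro2, p1 g13; the mirror of `CaseOneCubic.lean`)

The cleared `(i)` is the four-term cubic
`N₁ = P(QB₁) P(AO) P(PD) + P(AB₁) P(PDoU) P(Q) − P(AB₁O) P(Q) P(PD) − P(QB₁) P(PDoU) P(A)` with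
`B₁ = {b ∈ C₁}` (`iExpr_eq_probs`), so `iExpr = triSum p ∅ τ KI` (**`iExpr_cubic`**) for the separable
kernel **`KI`**; **`TypedI`** is the typed `(i)`, and **`zSplitI_of_pinned`**: `TypedI ⟹ (i)`; with
`CaseOneCubic.zSplitII_of_pinned`, **`jOneOne_of_pinned`**: `TypedI ∧ TypedII ⟹ (J1₁)`. Nothing about
`TypedI` itself is claimed. -/

namespace Summit.Ventures.PercRepro2

namespace CaseOne

open CovForm

section KernelI
variable {V : Type*} {E : Type*} [Fintype E] [DecidableEq E] {R : Type*} [Field R]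

/-- `1_QB₁ = 1[b ∈ C₁] 1_Q`. -/
noncomputable def iQB₁ (ends : E → Sym2 V) (a₁ a₂ b : V) : Config E → R :=
  (connEvent ends a₁ b ∩ (connEvent ends a₁ a₂)ᶜ).indicator 1

/-- `1_AB₁ = 1[b ∈ C₁] 1[a₃ ∈ C₁] 1_Q`. -/
noncomputable def iAB₁ (ends : E → Sym2 V) (a₁ a₂ a₃ b : V) : Config E → R :=
  (connEvent ends a₁ b ∩ connEvent ends a₁ a₃ ∩ (connEvent ends a₁ a₂)ᶜ).indicator 1

/-- `1_AB₁O = 1[b ∈ C₁] 1[a₃ ∈ C₁] 1[o ∈ C₂] 1_Q`. -/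
noncomputable def iAB₁O (ends : E → Sym2 V) (o a₁ a₂ a₃ b : V) : Config E → R :=
  (connEvent ends a₁ b ∩ connEvent ends a₁ a₃ ∩ connEvent ends a₂ o ∩
    (connEvent ends a₁ a₂)ᶜ).indicator 1

/-- **The `(i)`-side state kernel**: `KI x y z = 1_QB₁(x) 1_AO(y) 1_PD(z) + 1_AB₁(x) 1_PDoU(y) 1_Q(z)
− 1_AB₁O(x) 1_Q(y) 1_PD(z) − 1_QB₁(x) 1_PDoU(y) 1_A(z)`. -/
noncomputable def KI (ends : E → Sym2 V) (o a₁ a₂ a₃ b : V) :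
    Config E → Config E → Config E → R :=
  sepKernel ![1, 1, -1, -1]
    ![iQB₁ ends a₁ a₂ b, iAB₁ ends a₁ a₂ a₃ b, iAB₁O ends o a₁ a₂ a₃ b, iQB₁ ends a₁ a₂ b]
    ![iAO ends o a₁ a₂ a₃, iPDoU ends o a₁ a₂ a₃, iQ ends a₁ a₂, iPDoU ends o a₁ a₂ a₃]
    ![iPDc ends a₁ a₂ a₃, iQ ends a₁ a₂, iPDc ends a₁ a₂ a₃, iA ends a₁ a₂ a₃]

/-- `iExpr` in event probabilities. -/
lemma iExpr_eq_probs' (p : E → R) (ends : E → Sym2 V) (o a₁ a₂ a₃ b : V) :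
    iExpr p ends o a₁ a₂ a₃ b =
      -(prob p (connEvent ends a₁ a₂)ᶜ *
          (Dpd p ends a₁ a₂ a₃ * prob p (connEvent ends a₁ b ∩ connEvent ends a₁ a₃ ∩
              connEvent ends a₂ o ∩ (connEvent ends a₁ a₂)ᶜ) -
            Dpdo p ends o a₁ a₂ a₃ * prob p (connEvent ends a₁ b ∩ connEvent ends a₁ a₃ ∩
              (connEvent ends a₁ a₂)ᶜ)) -
        prob p (connEvent ends a₁ b ∩ (connEvent ends a₁ a₂)ᶜ) *
          (Dpd p ends a₁ a₂ a₃ * prob p (connEvent ends a₁ a₃ ∩ connEvent ends a₂ o ∩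
              (connEvent ends a₁ a₂)ᶜ) -
            Dpdo p ends o a₁ a₂ a₃ * prob p (connEvent ends a₁ a₃ ∩ (connEvent ends a₁ a₂)ᶜ))) := by
  unfold iExpr zFun
  have e1 : expect p (fun ω => (connEvent ends a₁ b).indicator (1 : Config E → R) ω *
      ((connEvent ends a₁ a₃).indicator 1 ω *
        (Dpd p ends a₁ a₂ a₃ * (connEvent ends a₂ o).indicator 1 ω - Dpdo p ends o a₁ a₂ a₃)) *
      ((connEvent ends a₁ a₂)ᶜ).indicator 1 ω) =
      expect p (fun ω => ((connEvent ends a₁ b).indicator (1 : Config E → R) ω *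
        (connEvent ends a₁ a₃).indicator 1 ω) *
        (Dpd p ends a₁ a₂ a₃ * (connEvent ends a₂ o).indicator 1 ω - Dpdo p ends o a₁ a₂ a₃) *
        ((connEvent ends a₁ a₂)ᶜ).indicator 1 ω) := by
    congr 1
    funext ω
    ring
  rw [e1, expect_mul_affine, expect_mul_affine]
  simp only [expect_ind4, expect_ind3, expect_ind2]

/-- **`iExpr` is the cubic form of `KI`**. -/
theorem iExpr_cubic (p : E → R) (ends : E → Sym2 V) (o a₁ a₂ a₃ b : V) (τ : E → ℕ) :
    iExpr p ends o a₁ a₂ a₃ b = triSum p ∅ τ (KI ends o a₁ a₂ a₃ b) := by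
  unfold KI
  rw [triSum_empty_sepKernel]
  simp only [Fin.sum_univ_succ, Fin.sum_univ_zero, Matrix.cons_val_zero, Matrix.cons_val_succ,
    add_zero]
  unfold iQ iA iAO iPDc iPDoU iQB₁ iAB₁ iAB₁O
  simp only [← prob_eq_expect_indicator]
  rw [iExpr_eq_probs']
  unfold Dpd Dpdo
  ring

end KernelI

section TypedI
variable {V : Type*} {E : Type*} [Fintype E] [DecidableEq E] {R : Type*} [Field R] [LinearOrder R]
  [IsStrictOrderedRing R]

/-- **The typed `(i)`**: every typed three-copy sum of `KI` with the free edges pinned is nonnegative.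
A definition only. -/
def TypedI (ends : E → Sym2 V) (o a₁ a₂ a₃ b : V) : Prop :=
  ∀ (q : E → R) (G : Finset E) (σ : E → ℕ), (∀ e, 0 ≤ q e ∧ q e ≤ 1) →
    (∀ e, e ∉ G → q e = 0 ∨ q e = 1) → (∀ e ∈ G, σ e = 1 ∨ σ e = 2) →
    0 ≤ triSum q G σ (KI ends o a₁ a₂ a₃ b)

/-- **`(i)` from the typed three-copy bases**: `TypedI ⟹ ZSplitI` for every admissible weight vector. -/
theorem zSplitI_of_pinned (ends : E → Sym2 V) (o a₁ a₂ a₃ b : V)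
    (hbase : TypedI (R := R) ends o a₁ a₂ a₃ b) (p : E → R) (hp : IsProbVec p) :
    ZSplitI p ends o a₁ a₂ a₃ b := by
  unfold ZSplitI
  rw [iExpr_cubic p ends o a₁ a₂ a₃ b (fun _ => 0)]
  exact triSum_nonneg_of_pinned (KI ends o a₁ a₂ a₃ b) hbase p
    (fun e => ⟨hp.nonneg e, hp.le_one e⟩) ∅ (fun _ => 0)
    (fun e he => absurd he (Finset.notMem_empty e))

/-- **`(J1₁)` from the typed bases of both rows**: `TypedI ∧ TypedII ⟹ JOneOne`. -/
theorem jOneOne_of_pinned (ends : E → Sym2 V) (o a₁ a₂ a₃ b : V)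
    (hI : TypedI (R := R) ends o a₁ a₂ a₃ b) (hII : TypedII (R := R) ends o a₁ a₂ a₃ b)
    (p : E → R) (hp : IsProbVec p) : JOneOne p ends o a₁ a₂ a₃ b :=
  jOneOne_of_i_of_ii p ends o a₁ a₂ a₃ b (zSplitI_of_pinned ends o a₁ a₂ a₃ b hI p hp)
    (zSplitII_of_pinned ends o a₁ a₂ a₃ b hII p hp)

end TypedI

end CaseOne

end Summit.Ventures.PercRepro2
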